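import Summits.QuantumFields.BalabanUV.T4Continuum.Support.NE3FramePotBoundSharp
import HarnessLib

/-!
# T⁴ programme, node NE3, route (H♮) row H4-W (= K5-spk) — THE SHARP FRAME BOUND AT A CURVED BACKGROUND: `48·Dfp d L ↦ 48·(d·L)`
# `Σ_{z∈periodBox N} ‖framePotW L (j+1) W Y z‖² ≤ 48·(d·L)·l2sq (periodBox (L^{j+1}·N)) Y`

NE3 formalisation swarm `b2b-balaban-t4-ne3-formalise-*`, LEAF PROVER 04 (gen 6), the author lineage of H4-W `NE3FramePotBoundW` (p232724, g5);
file 2∕2 of the sharpening located by the row's disprover (D-ne3r2-g9-3 (5): «THE BINDING LINE OF ROUTE H♮'S CENSUS IS H4-W's BOX COUNT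
`(2dL+1)^{2d}`»).  File 1 `NE3FramePotBoundSharp` proved the block-local one-level bound `sum_norm_Fbar_sq_le_torus` (any unitary `U`:
`Σ_{z∈periodBox N} ‖Fbar L U V ((L^j)•z)‖² ≤ d·L·l2sq (periodBox (L^{j+1}·N)) V` — tree contours against their OWN block, exact tiling, sparse
centres inject) and the flat END♯.  THIS FILE is H4-W's §3–§4 VERBATIM with that one-level bound in place of the box bound: the level-`m` term
carries `4·(L²∕L^d)^m` from this lineage's C1 ℓ² towers (`NE3FramePotBoundW.l2sq_QbarIter_le` BY NAME, class `S2sum d L (j+1) x ≤ ρ∕2`), Sedrakyan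
with weights `(3∕4)^m`, `(L²∕L^d)·(4∕3) ≤ 2∕3` (`3 ≤ d`, `2 ≤ L`), geometric sums `≤ 4` and `≤ 3`.

CONTENT (all [folklore]; 0 sorry; 0 def): `sum_norm_Fbar_QbarIter_sq_le_sharp` (one term on the torus, `4·(d·L)·(L²∕L^d)^m`) and the END
**`sum_norm_framePotW_sq_le_sharp`**: for `3 ≤ d`, `2 ≤ L`, `1 ≤ N`, unitary `(L^{j+1}·N)`-periodic `W` with `0 ≤ x`, `LevelSmall d L j x`,
`SmallField W x`, `S2sum d L (j+1) x ≤ ρ∕2`, and an `(L^{j+1}·N)`-periodic `Y`: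
`Σ_{z∈periodBox N} ‖framePotW L (j+1) W Y z‖² ≤ 48·(d·L)·l2sq (periodBox (L^{j+1}·N)) Y` — THE SAME BINDERS as `NE3FramePotBoundW.sum_norm_framePotW_sq_le`
(`hd hL hN j hWu hWP hx hsm hWx hS hY`), so every consumer (K6c's spike letter, H5a-type sockets) instantiates either by name; d = 4, L = 2:
`384` in place of `8.6·10¹³`.  H4-W stays as landed; nothing is re-filed.

HONEST FRAMING.  Lattice kinematics on OUR frame: a displayed constant of the (P♮)_W census shrinks, nothing else; nothing about Bałaban's
minimisers; (P♮)_W, (ML_w) at W ≠ 1, T-E_w and NE3 are NOT proved; spine PROVED 0∕9; finite T⁴ rung (B)+1 — NOT infinite volume, NOT mass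
gap, NOT BetaPertH, NOT Clay.  ABSOLUTE RULE kept (no printed sentence is a hypothesis).  PLACEMENT: `Summits/QuantumFields/BalabanUV/`.
HONEST DEPENDENCY: continuum YM on T⁴ ⇐ BetaPertH ∧ nine spine estimates (0/9 proved); BetaPertH ⇐ (D1) ∧ (D4) ∧ CAP+tail; G-an2-4
gates asym, D1 and NE2/3/4.
-/

set_option autoImplicit false

open scoped BigOperators Matrix.Norms.L2Operator
open Finset

namespace Summit.QuantumFields.BalabanUV.T4Continuum.NE3FramePotBoundWSharp

open Literature.MathematicalPhysics.QuantumFieldTheory.Balaban1983to89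
open B7Prop1Explicit B7Prop2Explicit
open T4AveragingDeficitWall (IsUnitaryCfg SmallField)
open T4AveragingDeficitWallBoundary (periodBox IsPeriodicCfg)
open AveragingDeficitPeriodicCounting (IsPeriodicDir)
open AveragingDeficitMultiLevelPrep (cavgIter LevelSmall cavgIter_unitary_small)
open NE3TangentCovariantStructure (Fbar)
open NE3TangentCovariantTower (QbarIter framePotW)
open NE3CovariantLineSumsL2 (l2sq l2sq_nonneg)
open NE3CovariantLineSumsL2Tower (rho S2sum)
open NE3FramePotBound (ratio_le geom_sum_le_inv)
open NE3FramePotBoundW (framePotW_eq_sum l2sq_QbarIter_le levelSmall_of_le)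
open NE3FramePotBoundSharp (sum_norm_Fbar_sq_le_torus)

noncomputable section

variable {d : ℕ} {n : Type*} [Fintype n] [DecidableEq n]

/-! ## §4 The frame bound at a curved background, sharp -/

/-- **ONE TERM ON THE TORUS (curved), SHARP**: for `j + 1 + m` levels, the level-`m` linearised frame of the level-`m` field at the level-`m`
background read at `(L^j)•z`: `Σ_{z∈periodBox N} ‖Fbar L (cavgIter L m W) (QbarIter L m W Y) ((L^j)•z)‖² ≤ 4·(d·L)·(L²∕L^d)^m·l2sq (periodBox (L^{j+1+m}·N)) Y`
— H4-W's `sum_norm_Fbar_QbarIter_sq_le` with `Dfp d L` replaced by `d·L` (same tower class; `l2sq_QbarIter_le` BY NAME). [folklore] -/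
theorem sum_norm_Fbar_QbarIter_sq_le_sharp [Nonempty n] {L : ℕ} (hL : 1 ≤ L) {N : ℕ} (hN : 1 ≤ N) (j m : ℕ) {i : ℕ} (hmi : m ≤ i + 1)
    {W : Site d → Fin d → (Matrix n n ℂ)ˣ} {x : ℝ} (hWu : IsUnitaryCfg W) (hWP : IsPeriodicCfg W ((L ^ (j + 1 + m) * N : ℕ) : ℤ))
    (hx : 0 ≤ x) (hsm : LevelSmall d L i x) (hWx : SmallField W x) (hS : S2sum d L (i + 1) x ≤ rho d L / 2)
    {Y : Site d → Fin d → Matrix n n ℂ} (hY : IsPeriodicDir Y ((L ^ (j + 1 + m) * N : ℕ) : ℤ)) :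
    ∑ z ∈ periodBox (d := d) N, ‖Fbar L (cavgIter L m W) (QbarIter L m W Y) (((L : ℤ) ^ j) • z)‖ ^ 2
      ≤ 4 * ((d : ℝ) * L) * ((L : ℝ) ^ 2 / (L : ℝ) ^ d) ^ m * l2sq (periodBox (d := d) (L ^ (j + 1 + m) * N)) Y := by
  have hPe : L ^ (j + 1 + m) * N = L ^ m * (L ^ (j + 1) * N) := by ring
  have hP : 1 ≤ L ^ (j + 1) * N := Nat.one_le_iff_ne_zero.mpr (Nat.mul_ne_zero (pow_ne_zero _ (by omega)) (by omega))
  -- the level-`m` background is unitary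
  have hUu : IsUnitaryCfg (cavgIter L m W) := by
    cases m with
    | zero => exact hWu
    | succ m => exact (cavgIter_unitary_small hL m hWu hx (levelSmall_of_le (by omega) hsm) hWx).1
  have h1 := sum_norm_Fbar_sq_le_torus (d := d) hL j N hUu (QbarIter L m W Y)
  have hl2 := l2sq_QbarIter_le (d := d) hL hP m hmi hWu (by rw [← hPe]; exact hWP) hx hsm hWx hS (Y := Y) (by rw [← hPe]; exact hY)
  rw [← hPe] at hl2
  calc ∑ z ∈ periodBox (d := d) N, ‖Fbar L (cavgIter L m W) (QbarIter L m W Y) (((L : ℤ) ^ j) • z)‖ ^ 2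
      ≤ ((d : ℝ) * L) * l2sq (periodBox (d := d) (L ^ (j + 1) * N)) (QbarIter L m W Y) := h1
    _ ≤ ((d : ℝ) * L) * (4 * ((L : ℝ) ^ 2 / (L : ℝ) ^ d) ^ m * l2sq (periodBox (d := d) (L ^ (j + 1 + m) * N)) Y) :=
        mul_le_mul_of_nonneg_left hl2 (by positivity)
    _ = 4 * ((d : ℝ) * L) * ((L : ℝ) ^ 2 / (L : ℝ) ^ d) ^ m * l2sq (periodBox (d := d) (L ^ (j + 1 + m) * N)) Y := by ring

/-- **H4-W♯ — THE SHARP FRAME BOUND AT A CURVED BACKGROUND**: for `3 ≤ d`, `2 ≤ L`, `1 ≤ N`, a unitary `(L^{j+1}·N)`-periodic `W` in the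
tower's small-field class (`0 ≤ x`, `LevelSmall d L j x`, `SmallField W x`, `S2sum d L (j+1) x ≤ ρ∕2`) and an `(L^{j+1}·N)`-periodic `Y`:
`Σ_{z∈periodBox N} ‖framePotW L (j+1) W Y z‖² ≤ 48·(d·L)·Σ_{x∈periodBox (L^{j+1}·N)} Σ_κ ‖Y x κ‖²` — H4-W's `sum_norm_framePotW_sq_le` (p232724) with
the SAME binders and `Dfp d L` replaced by `d·L` (k-FREE, N-FREE; d = 4, L = 2: `384`). [folklore] -/
theorem sum_norm_framePotW_sq_le_sharp [Nonempty n] (hd : 3 ≤ d) {L : ℕ} (hL : 2 ≤ L) {N : ℕ} (hN : 1 ≤ N) (j : ℕ)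
    {W : Site d → Fin d → (Matrix n n ℂ)ˣ} {x : ℝ} (hWu : IsUnitaryCfg W) (hWP : IsPeriodicCfg W ((L ^ (j + 1) * N : ℕ) : ℤ))
    (hx : 0 ≤ x) (hsm : LevelSmall d L j x) (hWx : SmallField W x) (hS : S2sum d L (j + 1) x ≤ rho d L / 2)
    {Y : Site d → Fin d → Matrix n n ℂ} (hY : IsPeriodicDir Y ((L ^ (j + 1) * N : ℕ) : ℤ)) :
    ∑ z ∈ periodBox (d := d) N, ‖framePotW L (j + 1) W Y z‖ ^ 2 ≤ 48 * ((d : ℝ) * L) * l2sq (periodBox (d := d) (L ^ (j + 1) * N)) Y := by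
  have hL1 : 1 ≤ L := by omega
  have hD0 : 0 ≤ (d : ℝ) * L := by positivity
  have hS0 : 0 ≤ l2sq (periodBox (d := d) (L ^ (j + 1) * N)) Y := l2sq_nonneg _ _
  set k : ℕ := j + 1 with hk
  have hkpos : 0 < k := by omega
  -- notation: the terms `a m z` and the weights `w m = (3/4)^m`
  set ρ2 : ℝ := (L : ℝ) ^ 2 / (L : ℝ) ^ d with hρ2
  have hρ0 : 0 ≤ ρ2 := by rw [hρ2]; positivity
  have hρq : ρ2 * (4 / 3) ≤ 2 / 3 := ratio_le (d := d) hd hL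
  set a : ℕ → Site d → ℝ := fun m z => ‖Fbar L (cavgIter L m W) (QbarIter L m W Y) (((L : ℤ) ^ (k - 1 - m)) • z)‖ with ha
  set w : ℕ → ℝ := fun m => (3 / 4 : ℝ) ^ m with hw
  have hwpos : ∀ m ∈ range k, 0 < w m := fun m _ => by rw [hw]; positivity
  have hwsum : ∑ m ∈ range k, w m ≤ 4 := by
    have := geom_sum_le_inv (q := (3 / 4 : ℝ)) (by norm_num) (by norm_num) k
    simpa [hw] using this.trans (by norm_num)
  have hwsum0 : 0 < ∑ m ∈ range k, w m := Finset.sum_pos hwpos ⟨0, Finset.mem_range.mpr hkpos⟩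
  -- (1) pointwise: `‖framePotW‖ ≤ Σ_m a m z` and Sedrakyan
  have hpt : ∀ z : Site d, ‖framePotW L k W Y z‖ ^ 2 ≤ 4 * ∑ m ∈ range k, a m z ^ 2 / w m := by
    intro z
    have h1 : ‖framePotW L k W Y z‖ ≤ ∑ m ∈ range k, a m z := by
      rw [framePotW_eq_sum]; exact norm_sum_le _ _
    have h2 := Finset.sq_sum_div_le_sum_sq_div (range k) (fun m => a m z) hwpos
    have h3 : (∑ m ∈ range k, a m z) ^ 2 ≤ (∑ m ∈ range k, w m) * ∑ m ∈ range k, a m z ^ 2 / w m := by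
      rw [div_le_iff₀ hwsum0] at h2; linarith [h2]
    have h4 : 0 ≤ ∑ m ∈ range k, a m z ^ 2 / w m :=
      Finset.sum_nonneg fun m hm => div_nonneg (sq_nonneg _) (hwpos m hm).le
    calc ‖framePotW L k W Y z‖ ^ 2 ≤ (∑ m ∈ range k, a m z) ^ 2 := pow_le_pow_left₀ (norm_nonneg _) h1 2
      _ ≤ (∑ m ∈ range k, w m) * ∑ m ∈ range k, a m z ^ 2 / w m := h3
      _ ≤ 4 * ∑ m ∈ range k, a m z ^ 2 / w m := mul_le_mul_of_nonneg_right hwsum h4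
  -- (2) the torus sum of each weighted term
  have hterm : ∀ m ∈ range k, ∑ z ∈ periodBox (d := d) N, a m z ^ 2 / w m
      ≤ 4 * ((d : ℝ) * L) * (2 / 3 : ℝ) ^ m * l2sq (periodBox (d := d) (L ^ k * N)) Y := by
    intro m hm
    have hmk : m < k := Finset.mem_range.mp hm
    have hjm : k - 1 - m + 1 + m = k := by omega
    have hWP' : IsPeriodicCfg W ((L ^ (k - 1 - m + 1 + m) * N : ℕ) : ℤ) := by rw [hjm]; exact hWP
    have hY' : IsPeriodicDir Y ((L ^ (k - 1 - m + 1 + m) * N : ℕ) : ℤ) := by rw [hjm]; exact hY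
    have h := sum_norm_Fbar_QbarIter_sq_le_sharp (d := d) hL1 hN (k - 1 - m) m (i := j) (by omega) hWu hWP' hx hsm hWx hS hY'
    rw [hjm] at h
    rw [← Finset.sum_div]
    have hw' : w m = (3 / 4 : ℝ) ^ m := rfl
    rw [div_le_iff₀ (hwpos m hm), hw']
    have hD4 : 0 ≤ 4 * ((d : ℝ) * L) := by positivity
    calc ∑ z ∈ periodBox (d := d) N, a m z ^ 2 ≤ 4 * ((d : ℝ) * L) * ρ2 ^ m * l2sq (periodBox (d := d) (L ^ k * N)) Y := h
      _ ≤ 4 * ((d : ℝ) * L) * ((2 / 3 : ℝ) ^ m * (3 / 4 : ℝ) ^ m)⁻¹⁻¹ * l2sq (periodBox (d := d) (L ^ k * N)) Y := by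
          rw [inv_inv]
          refine mul_le_mul_of_nonneg_right (mul_le_mul_of_nonneg_left ?_ hD4) hS0
          rw [← mul_pow]
          exact pow_le_pow_left₀ hρ0 (by nlinarith) m
      _ = 4 * ((d : ℝ) * L) * (2 / 3 : ℝ) ^ m * l2sq (periodBox (d := d) (L ^ k * N)) Y * (3 / 4 : ℝ) ^ m := by rw [inv_inv]; ring
  -- (3) assemble
  have hgeo : ∑ m ∈ range k, (2 / 3 : ℝ) ^ m ≤ 3 := by
    have := geom_sum_le_inv (q := (2 / 3 : ℝ)) (by norm_num) (by norm_num) k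
    exact this.trans (by norm_num)
  calc ∑ z ∈ periodBox (d := d) N, ‖framePotW L k W Y z‖ ^ 2
      ≤ ∑ z ∈ periodBox (d := d) N, 4 * ∑ m ∈ range k, a m z ^ 2 / w m := Finset.sum_le_sum fun z _ => hpt z
    _ = 4 * ∑ m ∈ range k, ∑ z ∈ periodBox (d := d) N, a m z ^ 2 / w m := by rw [← Finset.mul_sum, Finset.sum_comm]
    _ ≤ 4 * ∑ m ∈ range k, 4 * ((d : ℝ) * L) * (2 / 3 : ℝ) ^ m * l2sq (periodBox (d := d) (L ^ k * N)) Y :=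
        mul_le_mul_of_nonneg_left (Finset.sum_le_sum hterm) (by norm_num)
    _ = 16 * (((d : ℝ) * L) * l2sq (periodBox (d := d) (L ^ k * N)) Y) * ∑ m ∈ range k, (2 / 3 : ℝ) ^ m := by
        simp only [Finset.mul_sum]; exact Finset.sum_congr rfl fun m _ => by ring
    _ ≤ 16 * (((d : ℝ) * L) * l2sq (periodBox (d := d) (L ^ k * N)) Y) * 3 :=
        mul_le_mul_of_nonneg_left hgeo (by positivity)
    _ = 48 * ((d : ℝ) * L) * l2sq (periodBox (d := d) (L ^ k * N)) Y := by ring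

end

end Summit.QuantumFields.BalabanUV.T4Continuum.NE3FramePotBoundWSharp
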